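import Mathlib
import Literature.Computability.AlgebraicComplexity.GroupTheoreticMatMul
import Summits.MatrixMultiplication.MatrixMultiplication.Theses.ThinBlockAlpha

set_option linter.dupNamespace false

/-!
# Sketch (crux-ideate round 2, ideator 4) — ORBIT DESIGNS / TWISTED TEMPLATES for `ThinPackings`

Idea card `automorphism-orbit-twisted-templates` (crux stmt-MatrixMultiplication-10595).
`lean check` rc 0, no `sorry`.  PROVED here: the ORBIT CRITERION `orbitCriterion_holds`
(an orbit family `(γ•A, γ•B, γ•C)_{γ∈Γ}` is STPP iff the single template is TPP and
`Γ`-twisted sum-free) and the TRANSFER `orbitTransfer_holds : OrbitThinPackings → ThinPackings`.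
OPEN (the line's heart): `OrbitThinPackings`; first finite instance: `CubicTranslationGain`.
-/

namespace Summit.MatrixMultiplication.MatrixMultiplication.Cruxes.ThinPackings.Ideator4

open Finset Literature.Computability.AlgebraicComplexity

section Orbit

variable (Γ : Type) {H : Type} [Group Γ] [Fintype Γ] [AddCommGroup H] [DecidableEq H]
  [DistribMulAction Γ H]

noncomputable def orbitLeg (S : Finset H) (i : Fin (Fintype.card Γ)) : Finset H :=
  S.image fun x => ((Fintype.equivFin Γ).symm i) • x

def TemplateTPP (A B C : Finset H) : Prop :=
  ∀ a ∈ A, ∀ a' ∈ A, ∀ b ∈ B, ∀ b' ∈ B, ∀ c ∈ C, ∀ c' ∈ C,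
    (a' - a) + (b' - b) + (c' - c) = 0 → a = a' ∧ b = b' ∧ c = c'

def TwistedSumFree (A B C : Finset H) : Prop :=
  ∀ g h : Γ, (g, h) ≠ (1, 1) →
    ∀ a' ∈ A, ∀ b ∈ B, ∀ b' ∈ B, ∀ c ∈ C, ∀ c' ∈ C, ∀ a ∈ A,
      g • (a' - b) + h • (b' - c) + (c' - a) ≠ 0

end Orbit

def OrbitCriterion : Prop :=
  ∀ (Γ H : Type) [Group Γ] [Fintype Γ] [AddCommGroup H] [DecidableEq H]
    [DistribMulAction Γ H] (A B C : Finset H),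
    IsSTPP (orbitLeg Γ A) (orbitLeg Γ B) (orbitLeg Γ C) ↔
      TemplateTPP A B C ∧ TwistedSumFree Γ A B C

theorem mem_orbitLeg {Γ H : Type} [Group Γ] [Fintype Γ] [AddCommGroup H] [DecidableEq H]
    [DistribMulAction Γ H] (S : Finset H) (g : Γ) {x : H} (hx : x ∈ S) :
    g • x ∈ orbitLeg Γ S (Fintype.equivFin Γ g) := by
  simp only [orbitLeg, mem_image, Equiv.symm_apply_apply]
  exact ⟨x, hx, rfl⟩

/-- The algebraic identity behind the criterion: dividing a cross relation by its third label. -/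
theorem twist_identity {Γ H : Type} [Group Γ] [AddCommGroup H] [DistribMulAction Γ H]
    (γi γj γk : Γ) (a a' b b' c c' : H) :
    γk⁻¹ • ((γi • a' - γk • a) + (γj • b' - γi • b) + (γk • c' - γj • c)) =
      (γk⁻¹ * γi) • (a' - b) + (γk⁻¹ * γj) • (b' - c) + (c' - a) := by
  simp only [smul_add, smul_sub, mul_smul, inv_smul_smul]
  abel

theorem orbitCriterion_holds : OrbitCriterion := by
  intro Γ H _ _ _ _ _ A B C
  have hidx : ∀ g : Γ, (Fintype.equivFin Γ).symm (Fintype.equivFin Γ g) = g := fun g => by simp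
  constructor
  · intro hS
    refine ⟨?_, ?_⟩
    · intro a ha a' ha' b hb b' hb' c hc c' hc' hrel
      have h := hS (Fintype.equivFin Γ 1) (Fintype.equivFin Γ 1) (Fintype.equivFin Γ 1)
        ((1 : Γ) • a) (mem_orbitLeg A 1 ha) ((1 : Γ) • a') (mem_orbitLeg A 1 ha')
        ((1 : Γ) • b) (mem_orbitLeg B 1 hb) ((1 : Γ) • b') (mem_orbitLeg B 1 hb')
        ((1 : Γ) • c) (mem_orbitLeg C 1 hc) ((1 : Γ) • c') (mem_orbitLeg C 1 hc')
        (by simpa only [one_smul] using hrel)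
      simp only [one_smul] at h
      exact ⟨h.2.2.1, h.2.2.2.1, h.2.2.2.2⟩
    · intro g h hgh a' ha' b hb b' hb' c hc c' hc' a ha hrel
      have hh := hS (Fintype.equivFin Γ g) (Fintype.equivFin Γ h) (Fintype.equivFin Γ 1)
        ((1 : Γ) • a) (mem_orbitLeg A 1 ha) (g • a') (mem_orbitLeg A g ha')
        (g • b) (mem_orbitLeg B g hb) (h • b') (mem_orbitLeg B h hb')
        (h • c) (mem_orbitLeg C h hc) ((1 : Γ) • c') (mem_orbitLeg C 1 hc')
        (by rw [← hrel]; simp only [one_smul, smul_sub]; abel)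
      have hg : g = 1 := by
        have := congrArg (Fintype.equivFin Γ).symm (hh.1.trans hh.2.1)
        rwa [hidx, hidx] at this
      have hh' : h = 1 := by
        have := congrArg (Fintype.equivFin Γ).symm hh.2.1
        rwa [hidx, hidx] at this
      exact hgh (by rw [hg, hh'])
  · rintro ⟨hT, hTw⟩ i j k s hs s' hs' t ht t' ht' u hu u' hu' hrel
    simp only [orbitLeg, mem_image] at hs hs' ht ht' hu hu'
    obtain ⟨a, ha, rfl⟩ := hs
    obtain ⟨a', ha', rfl⟩ := hs'
    obtain ⟨b, hb, rfl⟩ := ht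
    obtain ⟨b', hb', rfl⟩ := ht'
    obtain ⟨c, hc, rfl⟩ := hu
    obtain ⟨c', hc', rfl⟩ := hu'
    have key := twist_identity ((Fintype.equivFin Γ).symm i) ((Fintype.equivFin Γ).symm j)
      ((Fintype.equivFin Γ).symm k) a a' b b' c c'
    rw [hrel, smul_zero] at key
    -- key : 0 = g • (a' - b) + h • (b' - c) + (c' - a)
    by_cases hgh : (((Fintype.equivFin Γ).symm k)⁻¹ * (Fintype.equivFin Γ).symm i,
        ((Fintype.equivFin Γ).symm k)⁻¹ * (Fintype.equivFin Γ).symm j) = ((1 : Γ), (1 : Γ))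
    · simp only [Prod.mk.injEq, inv_mul_eq_one] at hgh
      obtain ⟨hki, hkj⟩ := hgh
      have hik : i = k := (Fintype.equivFin Γ).symm.injective hki.symm
      have hjk : j = k := (Fintype.equivFin Γ).symm.injective hkj.symm
      subst hik; subst hjk
      simp only [inv_mul_cancel, one_smul] at key
      obtain ⟨rfl, rfl, rfl⟩ := hT a ha a' ha' b hb b' hb' c hc c' hc' (by rw [key]; abel)
      exact ⟨rfl, rfl, rfl, rfl, rfl⟩
    · exact absurd key.symm (hTw _ _ hgh a' ha' b hb b' hb' c hc c' hc' a ha)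


open Summit.MatrixMultiplication.MatrixMultiplication.Theses.ThinBlockAlpha (ThinPackings)

/-- THE LINE'S HEART (design statement, open): thin near-tight ORBIT designs exist for every
shape exponent — a finite abelian `H`, a finite group `Γ` of additive automorphisms and ONE
template `(A, B, C)` of shape `⟨N, M, N⟩`, TPP and `Γ`-twisted sum-free, with
`|H| ≤ |Γ| · N^{2+η}`.  Strictly stronger than `ThinPackings` (witnesses = orbit families). -/
def OrbitThinPackings : Prop :=
  ∀ a : ℝ, 0 ≤ a → a < 1 → ∀ η : ℝ, 0 < η →
    ∃ (Γ H : Type) (_ : Group Γ) (_ : Fintype Γ) (_ : AddCommGroup H) (_ : Fintype H)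
      (_ : DecidableEq H) (_ : DistribMulAction Γ H) (N M : ℕ) (A B C : Finset H),
      TemplateTPP A B C ∧ TwistedSumFree Γ A B C ∧
      A.card = N ∧ B.card = M ∧ C.card = N ∧ 2 ≤ N ∧ (N : ℝ) ^ a ≤ M ∧
      (Fintype.card H : ℝ) ≤ Fintype.card Γ * (N : ℝ) ^ (2 + η)

/-- GLUE: the transfer `OrbitThinPackings → ThinPackings`. -/
def OrbitTransfer : Prop := OrbitThinPackings → ThinPackings

theorem card_orbitLeg {Γ H : Type} [Group Γ] [Fintype Γ] [AddCommGroup H] [DecidableEq H]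
    [DistribMulAction Γ H] (S : Finset H) (i : Fin (Fintype.card Γ)) :
    (orbitLeg Γ S i).card = S.card :=
  card_image_of_injective _ (MulAction.injective _)

/-- PROVED: orbit designs feed the crux. -/
theorem orbitTransfer_holds : OrbitTransfer := by
  intro h a ha0 ha1 η hη
  obtain ⟨Γ, H, _, _, _, _, _, _, N, M, A, B, C, hT, hTw, hA, hB, hC, hN, hM, hcard⟩ :=
    h a ha0 ha1 η hη
  refine ⟨H, inferInstance, inferInstance, Fintype.card Γ, N, M, orbitLeg Γ A, orbitLeg Γ B,
    orbitLeg Γ C, (orbitCriterion_holds Γ H A B C).2 ⟨hT, hTw⟩, fun i => ?_, hN, hM, ?_⟩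
  · simp only [card_orbitLeg, hA, hB, hC, and_self]
  · exact_mod_cast hcard

/-- The first concrete instance the card proposes to decide (finite, explicit): TRANSLATION
ORBITS ON CUBICS.  `H = F_q[T]_{<4}` (coefficient vectors `Fin 4 → F`, `x i` = coefficient of
`T^i`), `Γ = (F, +)` acting by `f(T) ↦ f(T + λ)`; is there a template beating the coset bound,
`q · |A||B||C| > q ^ 4` ("gain > 1")?  (Numerology allows gain up to `≈ √q` here; `t = 3`
(quadratics) provably has gain `≤ 1`; generic templates fail; the bet is a Galois-twisted
template over `F_{p²}`.) -/
def translateCubic {F : Type} [Field F] (l : F) (x : Fin 4 → F) : Fin 4 → F :=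
  ![x 0 + x 1 * l + x 2 * l ^ 2 + x 3 * l ^ 3,
    x 1 + 2 * x 2 * l + 3 * x 3 * l ^ 2,
    x 2 + 3 * x 3 * l,
    x 3]

def CubicTranslationGain : Prop :=
  ∃ (F : Type) (_ : Field F) (_ : Fintype F) (_ : DecidableEq F)
    (A B C : Finset (Fin 4 → F)),
    TemplateTPP A B C ∧
    (∀ l m : F, (l, m) ≠ (0, 0) →
      ∀ a' ∈ A, ∀ b ∈ B, ∀ b' ∈ B, ∀ c ∈ C, ∀ c' ∈ C, ∀ a ∈ A,
        translateCubic l (a' - b) + translateCubic m (b' - c) + (c' - a) ≠ 0) ∧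
    Fintype.card F ^ 4 < Fintype.card F * (A.card * B.card * C.card)

/-- The scaling family the card proposes for `a → 1`: `Γ = GL_n(F_q)` acting by left
multiplication on `H = M_{n × (2n+1)}(F_q)` (`δ = log|Γ|/log|H| = n/(2n+1) → 1/2`, hence
thinness exponent up to `a = n/(n+1) → 1`).  The twisted-sum-free clause becomes a ROW-SPACE
condition; recorded here as the explicit matrix form of `TwistedSumFree`. -/
def MatrixTwistedSumFree (F : Type) [Field F] (n r : ℕ)
    (A B C : Finset (Matrix (Fin n) (Fin r) F)) : Prop :=
  ∀ g h : GL (Fin n) F, (g, h) ≠ (1, 1) →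
    ∀ a' ∈ A, ∀ b ∈ B, ∀ b' ∈ B, ∀ c ∈ C, ∀ c' ∈ C, ∀ a ∈ A,
      (g : Matrix (Fin n) (Fin n) F) * (a' - b) + (h : Matrix (Fin n) (Fin n) F) * (b' - c)
        + (c' - a) ≠ 0



/-! ## The deepest known sub-diagonal design is an ORBIT design (kernel-checked combinatorics)

`U₉` = the maximum `(4,1,4)` local strong USP of width 9 (Disproof.lean §9 `uspRow9`, Wedge C
`η > 5a/12`, via CKSU Thm 33 in `Cyc_ℓ⁹`, any `ℓ ≥ 3`).  Its nine rows are ONE orbit of row 0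
under an abelian group `P ≅ ℤ/3 × ℤ/3` of column permutations acting regularly (found by this
seat, `calc/usp_aut.py`; `|Aut(U₉)| = 72`).  Since the Thm-33 legs `uspA/uspB/uspC` are defined
coordinatewise from the row, permuting coordinates of `Cyc_ℓ⁹` by `P r` carries block 0 to block
`r`: the Wedge-C family is `{π • T₀ : π ∈ P}`, an orbit design with `|Γ| = 9` and gain
`9 (1 − 1/ℓ)⁹ → 9` (e.g. `3.49` at `ℓ = 10`) — so ORBIT DESIGNS DO BEAT THE COSET BOUND, in hosts
of unbounded exponent `ℓ`. -/

def U9 : Fin 9 → Fin 9 → Fin 3 :=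
  ![![1, 0, 0, 0, 0, 2, 2, 2, 2],
    ![0, 1, 0, 2, 2, 0, 0, 2, 2],
    ![0, 0, 1, 2, 2, 2, 2, 0, 0],
    ![0, 2, 2, 1, 0, 0, 2, 0, 2],
    ![0, 2, 2, 0, 1, 2, 0, 2, 0],
    ![2, 0, 2, 0, 2, 1, 0, 0, 2],
    ![2, 0, 2, 2, 0, 0, 1, 2, 0],
    ![2, 2, 0, 0, 2, 0, 2, 1, 0],
    ![2, 2, 0, 2, 0, 2, 0, 0, 1]]

/-- The regular abelian subgroup of `Aut(U₉)`: `P r` is the column permutation carrying row 0 to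
row `r` (note `P r 0 = r`). -/
def P9 : Fin 9 → Fin 9 → Fin 9 :=
  ![![0, 1, 2, 3, 4, 5, 6, 7, 8],
    ![1, 2, 0, 5, 6, 7, 8, 3, 4],
    ![2, 0, 1, 7, 8, 3, 4, 5, 6],
    ![3, 5, 7, 4, 0, 6, 1, 8, 2],
    ![4, 6, 8, 0, 3, 1, 5, 2, 7],
    ![5, 7, 3, 6, 1, 8, 2, 4, 0],
    ![6, 8, 4, 1, 5, 2, 7, 0, 3],
    ![7, 3, 5, 8, 2, 4, 0, 6, 1],
    ![8, 4, 6, 2, 7, 0, 3, 1, 5]]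

/-- Row `r` of `U₉` is row 0 transported by the column permutation `P9 r`. -/
theorem U9_transport : ∀ r i : Fin 9, U9 r (P9 r i) = U9 0 i := by decide

/-- Every row is carried to a row: `U₉` is `P9`-invariant as a set of rows. -/
theorem U9_invariant : ∀ r s : Fin 9, ∃ q : Fin 9, ∀ i : Fin 9, U9 q (P9 r i) = U9 s i := by
  decide

/-- `P9` is closed under composition, commutative, and consists of injections: an abelian
permutation group of order 9 (hence `≅ (ℤ/3)²`, all non-identity elements have order 3). -/
theorem P9_closed : ∀ r s : Fin 9, ∃ q : Fin 9, ∀ i : Fin 9, P9 r (P9 s i) = P9 q i := by decide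

theorem P9_comm : ∀ r s i : Fin 9, P9 r (P9 s i) = P9 s (P9 r i) := by decide

theorem P9_injective : ∀ r i j : Fin 9, P9 r i = P9 r j → i = j := by decide

theorem P9_cube : ∀ r i : Fin 9, P9 r (P9 r (P9 r i)) = i := by decide

end Summit.MatrixMultiplication.MatrixMultiplication.Cruxes.ThinPackings.Ideator4
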